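/-
Copyright (c) 2026 the pub-hodgecm-mathlib formalisation cell (harness21).  Prover seat hodgecm-mathlib-F0P3a-p08 (g19): «S3-ram» seeding wave (LEAD F0P3a-plan (g12),
owner F0P3a-p06 (g15)), row «P-1-ram (i) (N1) RAMIFIED LITERALS», split (a) «INTEGRAL ISOMETRY OF THE ε-TWISTED DIAGONAL UNIT FORMS» for F0P3b-p01 (g13)'s head
`UnitFundamentalLemmaRamifiedFlickerRepresentatives`; 2026-09-01.
-/
import Literature.NumberTheory.Rogawski1990.UnitaryVertexStabilizerSpanSelfDualTameRamifiedCM   -- ★ p846371 `ramifiedBlock_adicCompletion`; brings ★ p846344, ★ (F1a) `exists_glInt_eq_smul_formCongr_antidiagonal_of_isotropic`, ★ (F1b) `exists_primitive_v_pairing_self_lt_one`, ★ bridge `mem_glInt_iff_forall_v_le_one`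
import HarnessLib

/-!
# Integral isometries onto unimodular hermitian forms whose twisted discriminant is a norm — the frames of the ε-twisted diagonal unit forms `diag(ε^b₀, ε^b₁, −ε^(b₀+b₁))`
# and the integral torus literals `P·diag(x)·P⁻¹ ∈ U(σ, J₀) ∩ GL₃(𝒪)` they carry (Jacobowitz 1962 §8; Rogawski 1990 §3.5–§3.6, §4.9)

Topic `NumberTheory/Automorphic`; namespaces `Literature.NumberTheory.Automorphic.UnitaryLatticeTree` (§1–§2, any discretely valued field with involution) and
`Literature.NumberTheory.Rogawski1990` (§3, the CM place).  THEOREMS ONLY (no definition, no instance, no notation, no named fact, no `sorry`); kernel lane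
`--supports stmt-HodgeConjecture-24833`.  Cell `pub/hodgecm-mathlib` (D-0151), crux H413; «S3-ram» seeding wave, row «P-1-ram (i) (N1) RAMIFIED LITERALS» (owner table v1.4;
LEAD T11-56 (2) ∕ T11-60 (4) ∕ T11-61): the four `U(H′)(L⁺_v)`-classes inside the stable class of a deep type-(1) element at a TAMELY RAMIFIED non-split place are the
frame transports `P_b · diag(α, u, γ) · P_b⁻¹` of the diagonal torus along INTEGRAL isometries `P_b ∈ GL₃(𝒪_w)` from the ε-twisted diagonal unit forms
`D_b = diag(ε^b₀, ε^b₁, −ε^(b₀+b₁))` (`ε` a `σ_w`-fixed unit of non-square residue = the non-norm of record, ★ `exists_fixed_unit_norm_dichotomy_of_ramified_complexConj`) onto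
the split form `J₀ = antidiag(1,1,1)`; Flicker's inert closed-form literals `t_π, t₃, t₄` do not port (they need units of norm `±2`).  THIS FILE is the place-free organ
(split (a), F0P3b-p01 (g13) «WANT» 2026-09-01T21:58:29Z): the frames `P_b` EXIST and are integral, and the transported torus elements are integral points of `U(σ, J₀)` with
eigenframe `P_b` — so that (F0P3b-p01's head) the fixed-lattice sets of the literal `t_b` biject (`Λ ↦ P_b⁻¹Λ`, same base lattice `𝒪³`) onto those of the DIAGONAL torus for the
DIAGONAL form `D_b`, which is what the strata-count certificate of STUB A′ (ii) (A-p16 (g31) skeleton v1) enumerates.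
HONEST LABEL: HC_CM is proved only modulo the cell's 2 remaining named inputs (hLiu418 24832, h413 24833) until rung 0 closes; nothing printed is asserted here (elementary
lattice algebra over a Henselian valuation ring with residually trivial involution).

THE MATHEMATICS.  For `H ∈ M₃(𝒪)` `σ`-hermitian with `|det H| = 1` at a place where `σ̄ = id` on a FINITE residue field (tame ramification), ★ (F1b) Chevalley–Warning gives a
residually isotropic primitive vector and ★ (F1a) an `A ∈ GL₃(𝒪)` with `H = (−det H) • ᵗσ(A) J₀ A`.  The unit scalar `−det H` is absorbed into the frame exactly when it is a NORM
`σ(c)·c`: then `P = c·A ∈ GL₃(𝒪)` has `ᵗσ(P) J₀ P = H` (§2 `exists_glInt_formCongr_antidiagonal_eq_of_map_mul_self_eq_neg_det`).  For `H = D_b`, `−det D_b = ε^{2(b₀+b₁)} =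
σ(ε^{b₀+b₁})·ε^{b₀+b₁}` (§2 `exists_glInt_formCongr_antidiagonal_eq_diagonal_units`) — all four `D_b` are integrally isometric to `J₀` (unimodular hermitian lattices over a
ramified quadratic extension, `q` odd, are classified by rank and discriminant [Jacobowitz1962, §8]; `disc D_b ≡ disc J₀ = −1`).  §1: for ANY frame `ᵗσ(P) H P = diag(D)` and
norm-one units `x`, `P · diag(x) · P⁻¹ ∈ U(σ, H)` (`diag(x) ∈ U(σ, diag D)` and ★ `conj_mem_unitaryGroupOfForm_iff`), it lies in `GL_N(𝒪)` when `P` does, and `P` is its eigenframe.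
§3 discharges the block (R) hypotheses at a tamely ramified non-split CM place `w` (`e(w|v) ≠ 1`, `|2|_w = 1`) by ★ `ramifiedBlock_adicCompletion` — binders `(w hw he h2)` of record.

* §1 `conj_glDiagonal_mem_unitaryGroupOfForm_of_formCongr_eq_diagonal` (+ `_mem_glInt`, `_mul_eq`: integrality and the eigenframe), any `N`, any form.
* §2 `exists_glInt_formCongr_antidiagonal_eq_of_map_mul_self_eq_neg_det` (rank 3, `−det H` a norm), **`exists_glInt_formCongr_antidiagonal_eq_diagonal_units`** (the four `D_b`).
* §3 `exists_glInt_formCongr_antidiagonal_eq_of_map_mul_self_eq_neg_det_adicCompletion`, **`exists_glInt_formCongr_antidiagonal_eq_diagonal_units_adicCompletion`** (CM place).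

## References
* [Jacobowitz1962] R. Jacobowitz, *Hermitian forms over local fields*, Amer. J. Math. 84 (1962), §8 (ramified non-dyadic unimodular lattices: rank + discriminant).
* [Rogawski1990] J. D. Rogawski, *Automorphic Representations of Unitary Groups in Three Variables*, Ann. of Math. Stud. 123 (1990), §3.5 Prop. 3.5.2 p. 29, §3.6 p. 31
  (the four classes of a type-(1) torus), §4.9 p. 54–56.
* [Serre1979] J.-P. Serre, *Local Fields*, GTM 67 (1979), Ch. V §3 (norms of units in a tamely ramified quadratic extension).
* [Serre1973CourseArithmetic] J.-P. Serre, *A Course in Arithmetic* (1973), Ch. I §2 (Chevalley–Warning).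
-/

set_option autoImplicit false

noncomputable section

open scoped Valued WithZero Matrix MatrixGroups
open Matrix NumberField IsDedekindDomain

namespace Literature.NumberTheory.Automorphic.UnitaryLatticeTree

open Literature.NumberTheory.Automorphic Literature.NumberTheory.Automorphic.HermitianLattice

variable {K : Type*} [Field K] [Valued K ℤᵐ⁰] {σ : K →+* K}

/-! ## §1 Transported diagonal torus elements: `P · diag(x) · P⁻¹ ∈ U(σ, H) ∩ GL_N(𝒪)` with eigenframe `P` -/

section Conj

variable {N : ℕ}

omit [Valued K ℤᵐ⁰] in
/-- **A diagonal matrix of `σ`-norm-one units preserves every diagonal form**: `diag(x) ∈ U(σ, diag(D))` when `σ(xᵢ)·xᵢ = 1`.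
[cite: Rogawski1990, §3.6 p. 31] -/
theorem glDiagonal_mem_unitaryGroupOfForm_diagonal (D : Fin N → K) (x : Fin N → Kˣ) (hx : ∀ i, σ (x i : K) * x i = 1) :
    glDiagonal N K x ∈ unitaryGroupOfForm σ (diagonal D) := by
  rw [mem_unitaryGroupOfForm_iff, coe_glDiagonal, diagonal_map (map_zero σ), diagonal_transpose, diagonal_mul_diagonal, diagonal_mul_diagonal]
  congr 1
  funext i
  calc σ (x i : K) * D i * x i = (σ (x i : K) * x i) * D i := by ring
    _ = D i := by rw [hx i, one_mul]

omit [Valued K ℤᵐ⁰] in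
/-- **THE TRANSPORTED TORUS ELEMENT IS IN `U(σ, H)`**: if `ᵗσ(P) H P = diag(D)` (a frame of `H` with diagonal Gram matrix) and `σ(xᵢ)·xᵢ = 1`, then `P · diag(x) · P⁻¹ ∈ U(σ, H)`
(★ `conj_mem_unitaryGroupOfForm_iff`). [cite: Rogawski1990, §3.5 Prop. 3.5.2 p. 29, §3.6 p. 31] -/
theorem conj_glDiagonal_mem_unitaryGroupOfForm_of_formCongr_eq_diagonal {H : Matrix (Fin N) (Fin N) K} {P : GL (Fin N) K} {D : Fin N → K}
    (hPD : formCongr σ P H = diagonal D) (x : Fin N → Kˣ) (hx : ∀ i, σ (x i : K) * x i = 1) :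
    P * glDiagonal N K x * P⁻¹ ∈ unitaryGroupOfForm σ H := by
  rw [conj_mem_unitaryGroupOfForm_iff, hPD]
  exact glDiagonal_mem_unitaryGroupOfForm_diagonal D x hx

omit [Valued K ℤᵐ⁰] in
/-- **`P` is an eigenframe of the transported element**: `(P · diag(x) · P⁻¹) · P = P · diag(x)`. [cite: Rogawski1990, §3.1 p. 19] -/
theorem conj_glDiagonal_mul_eq (P : GL (Fin N) K) (x : Fin N → Kˣ) :
    ((P * glDiagonal N K x * P⁻¹ : GL (Fin N) K) : Matrix (Fin N) (Fin N) K) * P = P * diagonal (fun i => (x i : K)) := by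
  rw [← coe_glDiagonal, ← Units.val_mul, ← Units.val_mul, inv_mul_cancel_right]

/-- **Norm-one elements are units**: `σ(x)·x = 1` with `σ` isometric forces `|x| = 1`. [cite: Serre1979, Ch. II §1] -/
theorem v_eq_one_of_map_mul_self_eq_one_of_isometry (hvσ : ∀ a, Valued.v (σ a) = Valued.v a) {x : K} (hx : σ x * x = 1) : Valued.v x = 1 := by
  have h : Valued.v x * Valued.v x = 1 := by
    calc Valued.v x * Valued.v x = Valued.v (σ x) * Valued.v x := by rw [hvσ]
      _ = 1 := by rw [← map_mul, hx, map_one]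
  exact eq_one_of_mul_self_eq_one h

variable [ValuativeRel K] [(Valued.v : Valuation K ℤᵐ⁰).Compatible]

/-- `diag(x) ∈ GL_N(𝒪)` for units `|xᵢ| = 1`. [cite: Serre1979, Ch. II §1] -/
theorem glDiagonal_mem_glInt (x : Fin N → Kˣ) (hx : ∀ i, Valued.v (x i : K) = 1) : glDiagonal N K x ∈ glInt N K := by
  rw [mem_glInt_iff_forall_v_le_one, ← map_inv, coe_glDiagonal, coe_glDiagonal]
  refine ⟨fun i j => ?_, fun i j => ?_⟩
  · by_cases h : i = j
    · subst h; rw [diagonal_apply_eq, hx]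
    · rw [diagonal_apply_ne _ h, map_zero]; exact zero_le_one
  · by_cases h : i = j
    · subst h; rw [diagonal_apply_eq, Pi.inv_apply, Units.val_inv_eq_inv_val, map_inv₀, hx, inv_one]
    · rw [diagonal_apply_ne _ h, map_zero]; exact zero_le_one

/-- **THE TRANSPORTED TORUS ELEMENT IS INTEGRAL**: `P ∈ GL_N(𝒪)`, `σ` isometric and `σ(xᵢ)·xᵢ = 1` give `P · diag(x) · P⁻¹ ∈ GL_N(𝒪)`.
[cite: Rogawski1990, §4.9 p. 54] [cite: Serre1979, Ch. II §1] -/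
theorem conj_glDiagonal_mem_glInt (hvσ : ∀ a, Valued.v (σ a) = Valued.v a) {P : GL (Fin N) K} (hP : P ∈ glInt N K)
    (x : Fin N → Kˣ) (hx : ∀ i, σ (x i : K) * x i = 1) : P * glDiagonal N K x * P⁻¹ ∈ glInt N K :=
  Subgroup.mul_mem _ (Subgroup.mul_mem _ hP (glDiagonal_mem_glInt x fun i => v_eq_one_of_map_mul_self_eq_one_of_isometry hvσ (hx i))) (Subgroup.inv_mem _ hP)

/-- **THE INTEGRAL LITERAL OF A FRAME, packaged** (F0P3b-p01 (g13)'s «WANT (a)» second signature): for `P ∈ GL_N(𝒪)` with `ᵗσ(P) H P = diag(D)` and `σ`-norm-one units `x`,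
the element `t = P · diag(x) · P⁻¹` lies in `U(σ, H) ∩ GL_N(𝒪)` and `t · P = P · diag(x)` — the `i`-th column of `P` is an eigenvector of `t` for `xᵢ`, of `H`-length `Dᵢ`
(the norm-test slot of ★ `exists_unitary_conj_iff_forall_normTest_iff`). [cite: Rogawski1990, §3.5 Prop. 3.5.2 p. 29, §3.6 p. 31, §4.9 p. 54] -/
theorem conj_diagonal_mem_unitaryGroupOfForm_inter_glInt (hvσ : ∀ a, Valued.v (σ a) = Valued.v a) {H : Matrix (Fin N) (Fin N) K}
    {P : GL (Fin N) K} (hP : P ∈ glInt N K) {D : Fin N → K} (hPD : formCongr σ P H = diagonal D) (x : Fin N → Kˣ) (hx : ∀ i, σ (x i : K) * x i = 1) :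
    P * glDiagonal N K x * P⁻¹ ∈ unitaryGroupOfForm σ H ∧ P * glDiagonal N K x * P⁻¹ ∈ glInt N K ∧
      ((P * glDiagonal N K x * P⁻¹ : GL (Fin N) K) : Matrix (Fin N) (Fin N) K) * P = P * diagonal (fun i => (x i : K)) :=
  ⟨conj_glDiagonal_mem_unitaryGroupOfForm_of_formCongr_eq_diagonal hPD x hx, conj_glDiagonal_mem_glInt hvσ hP x hx, conj_glDiagonal_mul_eq P x⟩

end Conj

/-! ## §2 Integral isometries onto a unimodular hermitian form whose twisted discriminant `−det H` is a norm -/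

omit [Valued K ℤᵐ⁰] in
/-- `ᵗσ(c·A) H (c·A) = (σ(c)·c) • ᵗσ(A) H A`. [folklore] -/
private theorem formCongr_eq_smul_of_val_eq_smul {N : ℕ} (H : Matrix (Fin N) (Fin N) K) {P A : GL (Fin N) K} {c : K}
    (h : (P : Matrix (Fin N) (Fin N) K) = c • (A : Matrix (Fin N) (Fin N) K)) : formCongr σ P H = (σ c * c) • formCongr σ A H := by
  have hmap : (c • (A : Matrix (Fin N) (Fin N) K)).map σ = σ c • (A : Matrix (Fin N) (Fin N) K).map σ := by
    ext i j
    simp only [Matrix.map_apply, Matrix.smul_apply, smul_eq_mul, map_mul]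
  rw [formCongr, formCongr, h, hmap, Matrix.transpose_smul, Matrix.smul_mul, Matrix.smul_mul, Matrix.mul_smul, smul_smul]

/-- **AN INTEGRAL ISOMETRY `ᵗσ(P) J₀ P = H`, `P ∈ GL₃(𝒪)`, EXISTS WHEN `−det H` IS A NORM** — `σ` an isometric involution, residually trivial (`|σx − x| < 1` on `𝒪`: the TAMELY RAMIFIED
case) on a FINITE residue field, `|2| = 1`, (norm) for `σ`-fixed principal units; `H` `σ`-hermitian, integral, `|det H| = 1`, and `σ(c)·c = −det H`.  Proof: ★ (F1b) residual
isotropy + ★ (F1a) `H = (−det H) • ᵗσ(A) J₀ A`, then `P := c·A`. [cite: Jacobowitz1962, §8] [cite: Serre1973CourseArithmetic, Ch. I §2] -/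
theorem exists_glInt_formCongr_antidiagonal_eq_of_map_mul_self_eq_neg_det [ValuativeRel K] [(Valued.v : Valuation K ℤᵐ⁰).Compatible] [Finite 𝓀[K]]
    (hσ : ∀ a, σ (σ a) = a) (hvσ : ∀ a, Valued.v (σ a) = Valued.v a)
    (hres : ∀ x : K, Valued.v x ≤ 1 → Valued.v (σ x - x) < 1) (h2 : Valued.v (2 : K) = 1)
    (hnorm : ∀ u : K, σ u = u → Valued.v (u - 1) < 1 → ∃ z : K, z * σ z = u ∧ Valued.v (z - 1) ≤ Valued.v (u - 1))
    {H : Matrix (Fin 3) (Fin 3) K} (hH : (H.map σ)ᵀ = H) (hHint : IsIntMatrix H) (hdet : Valued.v H.det = 1)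
    {c : K} (hc : σ c * c = -H.det) :
    ∃ P : GL (Fin 3) K, P ∈ glInt 3 K ∧ formCongr σ P ((StdForm.antidiagonal 3).over K) = H := by
  have h20 : (2 : K) ≠ 0 := fun h => by rw [h, map_zero] at h2; exact zero_ne_one h2
  -- (trace): `t = 1∕2` (`σ` fixes `2`)
  have htrace : ∃ t : K, Valued.v t ≤ 1 ∧ t + σ t = 1 :=
    ⟨1 / 2, by rw [map_div₀, map_one, h2, div_one], by rw [map_div₀, map_one, map_ofNat, ← add_div, one_add_one_eq_two, div_self h20]⟩
  -- (F1b) residual isotropy, (F1a) the frame up to the scalar `−det H`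
  obtain ⟨x, hx, ⟨i, hxi⟩, hxx⟩ := exists_primitive_v_pairing_self_lt_one (σ := σ) hres hHint
  obtain ⟨A, hA, hA', hframe⟩ := exists_glInt_eq_smul_formCongr_antidiagonal_of_isotropic hσ hvσ htrace hnorm hH hHint hdet hx hxi hxx
  -- absorb the norm `−det H = σ(c)·c` into the frame: `P := c·A`
  have hHd0 : H.det ≠ 0 := fun h => by rw [h, map_zero] at hdet; exact zero_ne_one hdet
  have hc0 : c ≠ 0 := fun h => by rw [h, mul_zero] at hc; exact hHd0 (neg_eq_zero.1 hc.symm)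
  have hvc : Valued.v c = 1 := by
    have h : Valued.v c * Valued.v c = 1 := by
      calc Valued.v c * Valued.v c = Valued.v (σ c) * Valued.v c := by rw [hvσ]
        _ = 1 := by rw [← map_mul, hc, Valuation.map_neg, hdet]
    exact eq_one_of_mul_self_eq_one h
  have hdetA : Valued.v (A : Matrix (Fin 3) (Fin 3) K).det = 1 := v_det_eq_one_of_isIntMatrix_inv hA hA'
  have hPd : (c • (A : Matrix (Fin 3) (Fin 3) K)).det ≠ 0 := by
    rw [Matrix.det_smul, Fintype.card_fin]
    exact mul_ne_zero (pow_ne_zero _ hc0) fun h => by rw [h, map_zero] at hdetA; exact zero_ne_one hdetA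
  set P : GL (Fin 3) K := Matrix.GeneralLinearGroup.mkOfDetNeZero _ hPd with hP
  have hPval : (P : Matrix (Fin 3) (Fin 3) K) = c • (A : Matrix (Fin 3) (Fin 3) K) := rfl
  have hPint : IsIntMatrix (P : Matrix (Fin 3) (Fin 3) K) := fun k l => by
    rw [hPval, Matrix.smul_apply, smul_eq_mul, map_mul, hvc, one_mul]; exact hA k l
  have hPdet : Valued.v (P : Matrix (Fin 3) (Fin 3) K).det = 1 := by
    rw [hPval, Matrix.det_smul, Fintype.card_fin, map_mul, map_pow, hvc, one_pow, one_mul, hdetA]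
  have hPinv : IsIntMatrix ((P⁻¹ : GL (Fin 3) K) : Matrix (Fin 3) (Fin 3) K) := by
    rw [Matrix.coe_units_inv]; exact isIntMatrix_nonsing_inv_of_v_det_eq_one hPint hPdet
  refine ⟨P, (mem_glInt_iff_forall_v_le_one P).2 ⟨hPint, hPinv⟩, ?_⟩
  rw [formCongr_eq_smul_of_val_eq_smul _ hPval, hc]
  -- `(−det H) • ᵗσ(A) J₀ A = H`
  exact hframe.symm

/-- **THE FRAMES OF THE ε-TWISTED DIAGONAL UNIT FORMS** (F0P3b-p01 (g13)'s «WANT (a)» first signature): for a `σ`-fixed unit `ε` and `b₀ b₁ : ℕ` there is `P ∈ GL₃(𝒪)` with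
`ᵗσ(P) J₀ P = diag(ε^b₀, ε^b₁, −ε^(b₀+b₁))` — the four forms `(b₀, b₁) ∈ {0,1}²` are all INTEGRALLY isometric to `J₀`, since `−det = ε^{2(b₀+b₁)} = σ(ε^{b₀+b₁})·ε^{b₀+b₁}` is a norm
(unimodular hermitian lattices at a tamely ramified place: rank + discriminant). [cite: Jacobowitz1962, §8] [cite: Rogawski1990, §3.6 p. 31] [cite: Serre1979, Ch. V §3] -/
theorem exists_glInt_formCongr_antidiagonal_eq_diagonal_units [ValuativeRel K] [(Valued.v : Valuation K ℤᵐ⁰).Compatible] [Finite 𝓀[K]]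
    (hσ : ∀ a, σ (σ a) = a) (hvσ : ∀ a, Valued.v (σ a) = Valued.v a)
    (hres : ∀ x : K, Valued.v x ≤ 1 → Valued.v (σ x - x) < 1) (h2 : Valued.v (2 : K) = 1)
    (hnorm : ∀ u : K, σ u = u → Valued.v (u - 1) < 1 → ∃ z : K, z * σ z = u ∧ Valued.v (z - 1) ≤ Valued.v (u - 1))
    (ε : K) (hσε : σ ε = ε) (hε : Valued.v ε = 1) (b₀ b₁ : ℕ) :
    ∃ P : GL (Fin 3) K, P ∈ glInt 3 K ∧ formCongr σ P ((StdForm.antidiagonal 3).over K) = diagonal ![ε ^ b₀, ε ^ b₁, -(ε ^ (b₀ + b₁))] := by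
  have hdetD : (diagonal ![ε ^ b₀, ε ^ b₁, -(ε ^ (b₀ + b₁))]).det = -(ε ^ (b₀ + b₁) * ε ^ (b₀ + b₁)) := by
    rw [det_diagonal, Fin.prod_univ_three]
    simp only [Matrix.cons_val_zero, Matrix.cons_val_one, Matrix.cons_val]
    ring
  refine exists_glInt_formCongr_antidiagonal_eq_of_map_mul_self_eq_neg_det hσ hvσ hres h2 hnorm ?_ ?_ ?_ (c := ε ^ (b₀ + b₁)) ?_
  · -- hermitian: `σ` fixes the (diagonal) entries
    rw [diagonal_map (map_zero σ), diagonal_transpose]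
    congr 1
    funext k
    fin_cases k <;> simp [map_pow, map_neg, hσε]
  · -- integral
    intro k l
    by_cases h : k = l
    · subst h
      rw [diagonal_apply_eq]
      fin_cases k <;> simp [map_pow, Valuation.map_neg, hε]
    · rw [diagonal_apply_ne _ h, map_zero]; exact zero_le_one
  · rw [hdetD, Valuation.map_neg, map_mul, map_pow, hε, one_pow, one_mul]
  · rw [hdetD, neg_neg, map_pow, hσε]

end Literature.NumberTheory.Automorphic.UnitaryLatticeTree

/-! ## §3 At a tamely ramified non-split CM place: block (R) discharged by ★ `ramifiedBlock_adicCompletion` -/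

namespace Literature.NumberTheory.Rogawski1990

open Literature.NumberTheory.Automorphic Literature.NumberTheory.Automorphic.UnitaryGroup Literature.NumberTheory.GaloisRepresentations
open Literature.NumberTheory.Automorphic.UnitaryLatticeTree Literature.NumberTheory.Automorphic.HermitianLattice

variable (L : Type) [Field L] [NumberField L] [IsCMField L] {v : HeightOneSpectrum (𝓞 ↥(maximalRealSubfield L))}
  (w : PlacesOver L v) (hw : IsCMField.complexConj L • w.1 = w.1)

/-- **INTEGRAL ISOMETRY ONTO A UNIMODULAR HERMITIAN `H ∈ M₃(L_w)` AT A TAMELY RAMIFIED NON-SPLIT CM PLACE** (`e(w|v) ≠ 1`, `|2|_w = 1`): if `H` is `σ_w`-hermitian, integral with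
`|det H|_w = 1` and `σ_w(c)·c = −det H`, then `ᵗσ_w(P) J₀ P = H` for some `P ∈ GL₃(𝒪_w)` (§2 with block (R) from ★ `ramifiedBlock_adicCompletion`, finite residue field of `L_w`).
[cite: Jacobowitz1962, §8] [cite: Serre1979, Ch. V §3] -/
theorem exists_glInt_formCongr_antidiagonal_eq_of_map_mul_self_eq_neg_det_adicCompletion
    (he : v.asIdeal.ramificationIdx' w.1.asIdeal ≠ 1) (h2 : Valued.v (2 : w.1.adicCompletion L) = 1)
    {H : Matrix (Fin 3) (Fin 3) (w.1.adicCompletion L)} (hH : (H.map (galAdicCompletionMap (L := L) (IsCMField.complexConj L) hw))ᵀ = H) (hHint : IsIntMatrix H)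
    (hdet : Valued.v H.det = 1) {c : w.1.adicCompletion L} (hc : galAdicCompletionMap (L := L) (IsCMField.complexConj L) hw c * c = -H.det) :
    ∃ P : GL (Fin 3) (w.1.adicCompletion L), P ∈ glInt 3 (w.1.adicCompletion L) ∧
      formCongr (galAdicCompletionMap (L := L) (IsCMField.complexConj L) hw) P ((StdForm.antidiagonal 3).over (w.1.adicCompletion L)) = H := by
  have hσσ : ∀ x, galAdicCompletionMap (L := L) (IsCMField.complexConj L) hw (galAdicCompletionMap (L := L) (IsCMField.complexConj L) hw x) = x :=
    galAdicCompletionMap_galAdicCompletionMap_of_smul_eq (IsCMField.complexConj L) w (IsCMField.complexConj_ne_one L) hw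
  have hvσ : ∀ x, Valued.v (galAdicCompletionMap (L := L) (IsCMField.complexConj L) hw x) = Valued.v x := fun x =>
    valued_galAdicCompletionMap (L := L) (IsCMField.complexConj L) hw x
  obtain ⟨-, -, -, hres, hnorm⟩ := ramifiedBlock_adicCompletion L v w hw he h2
  haveI : Finite (𝓞 L ⧸ w.1.asIdeal) := Ideal.finiteQuotientOfFreeOfNeBot _ w.1.ne_bot
  haveI : Finite 𝓀[w.1.adicCompletion L] := inferInstance
  exact exists_glInt_formCongr_antidiagonal_eq_of_map_mul_self_eq_neg_det hσσ hvσ hres h2 hnorm hH hHint hdet hc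

/-- **THE FRAMES OF THE ε-TWISTED DIAGONAL UNIT FORMS AT A TAMELY RAMIFIED NON-SPLIT CM PLACE** (binders `(w hw he h2)` of record, ★ p846371): for a `σ_w`-fixed unit `ε ∈ L_w`
and `b₀ b₁ : ℕ` there is `P ∈ GL₃(𝒪_w)` with `ᵗσ_w(P) J₀ P = diag(ε^b₀, ε^b₁, −ε^(b₀+b₁))`.  With `ε` the non-norm unit of ★ `exists_fixed_unit_norm_dichotomy_of_ramified_complexConj`
and `(b₀, b₁) ∈ {0,1}²` these are the frames of the four ramified type-(1) literals `P_b · diag(α, u, γ) · P_b⁻¹` (§1). [cite: Jacobowitz1962, §8] [cite: Rogawski1990, §3.6 p. 31; §4.9 p. 54]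
[cite: Serre1979, Ch. V §3] -/
theorem exists_glInt_formCongr_antidiagonal_eq_diagonal_units_adicCompletion
    (he : v.asIdeal.ramificationIdx' w.1.asIdeal ≠ 1) (h2 : Valued.v (2 : w.1.adicCompletion L) = 1)
    (ε : w.1.adicCompletion L) (hσε : galAdicCompletionMap (L := L) (IsCMField.complexConj L) hw ε = ε) (hε : Valued.v ε = 1) (b₀ b₁ : ℕ) :
    ∃ P : GL (Fin 3) (w.1.adicCompletion L), P ∈ glInt 3 (w.1.adicCompletion L) ∧
      formCongr (galAdicCompletionMap (L := L) (IsCMField.complexConj L) hw) P ((StdForm.antidiagonal 3).over (w.1.adicCompletion L)) =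
        diagonal ![ε ^ b₀, ε ^ b₁, -(ε ^ (b₀ + b₁))] := by
  have hσσ : ∀ x, galAdicCompletionMap (L := L) (IsCMField.complexConj L) hw (galAdicCompletionMap (L := L) (IsCMField.complexConj L) hw x) = x :=
    galAdicCompletionMap_galAdicCompletionMap_of_smul_eq (IsCMField.complexConj L) w (IsCMField.complexConj_ne_one L) hw
  have hvσ : ∀ x, Valued.v (galAdicCompletionMap (L := L) (IsCMField.complexConj L) hw x) = Valued.v x := fun x =>
    valued_galAdicCompletionMap (L := L) (IsCMField.complexConj L) hw x
  obtain ⟨-, -, -, hres, hnorm⟩ := ramifiedBlock_adicCompletion L v w hw he h2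
  haveI : Finite (𝓞 L ⧸ w.1.asIdeal) := Ideal.finiteQuotientOfFreeOfNeBot _ w.1.ne_bot
  haveI : Finite 𝓀[w.1.adicCompletion L] := inferInstance
  exact exists_glInt_formCongr_antidiagonal_eq_diagonal_units hσσ hvσ hres h2 hnorm ε hσε hε b₀ b₁

end Literature.NumberTheory.Rogawski1990

end
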